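import Summits.ValiantsHypothesis.ValiantsHypothesis.Theorems.LacunarySymmetroidMatrixDescartesCensusSharpRowsLog
import Summits.ValiantsHypothesis.ValiantsHypothesis.Theorems.LacunarySymmetroidMatrixDescartesCensusLogNat
import Summits.ValiantsHypothesis.ValiantsHypothesis.Theorems.LacunarySymmetroidMatrixDescartesCensusZp219On000203082033Rows2
/-!
# `MatrixDescartes` census — W4 boundary layer: CIRCUIT-ROW FACTS (chunk 2) of the kernel kill of `ZP(2..19)` on `(0,2,3,8,20,33)`

HONEST FRAMING.  Object-search cell `pub-symmetroid`, item `DoorA26 = PosRootLawAt 2 6 19` (stmt-ValiantsHypothesis-19979, OPEN, typed,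
never asserted).  Companion («Hr») file of `…CensusZp219On…` (theorem `countP_posRoots_zp_2_19_le_on_0_2_3_8_20_33`): the weighted
circuit rows of its typed face-row-LP certificate in log form — for a fewnomial `Σ_{t<n} c_t X^{e_t}` with `n − 1` positive roots counted with
multiplicity (hypothesis `hZ`) and the support's exponent table (`hE`), each row `(r,s,u)` is `circuit_row_logs_of_table` (…CensusSharpRowsLog)
with the three closed multipliers of the Rows file(s).  Split out of the main so that the main stays within 400 lines (engine-2 g29's layout,
engine-1 g26's generator genzp5e1).  Nothing here is a statement about pencils by itself; nothing bounds `ζ_sym(2,6)`, decides `DoorA26`, or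
bears on `MatrixDescartes` (stmt-ValiantsHypothesis-18050) / `VP ≠ VNP`.

[folklore] The circuit number (weighted AM–GM) under Descartes-sharpness; no single source.
-/

-- `Summit.ValiantsHypothesis.ValiantsHypothesis.…` repeats a component by the D-0017 layout
-- (single-conjunct summit), which the `dupNamespace` linter flags; the name is mandated.
set_option linter.dupNamespace false

namespace Summit.ValiantsHypothesis.ValiantsHypothesis.Theorems.LacunarySymmetroidMatrixDescartes.Census

open Polynomial Finset
open scoped BigOperators Polynomial

set_option maxHeartbeats 1000000 in
/-- Circuit-row facts (chunk 2) of the typed certificate of `countP_posRoots_zp_2_19_le_on_0_2_3_8_20_33`, in log form over the exponent table,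
from sharpness (`circuit_row_logs_of_table`) and the closed multipliers of the companion Rows file(s). Generated. [folklore] -/
theorem zp_2_19_on_0_2_3_8_20_33_hr2 (e : ℕ → ℕ) (c : ℕ → ℝ)
    (he : ∀ i j, i < j → j < 18 → e i < e j)
    (hZ : 18 ≤ (∑ t ∈ range 18, C (c t) * X ^ (e t) : ℝ[X]).roots.countP (fun x => 0 < x) + 1)
    (hE : ∀ t, t < 18 → e t = ([3, 4, 5, 6, 8, 10, 11, 16, 20, 22, 23, 28, 33, 35, 36, 40, 41, 53] : List ℕ).getD t 0) :
    (7 * Real.log (7 : ℝ) + 5 * (Real.log |c 12| + Real.log (485431298352000000 : ℝ)) + 2 * (Real.log |c 15| + Real.log (4044526364196864000 : ℝ)) ≤ 7 * (Real.log |c 13| + Real.log (469934352276480000 : ℝ)) + 5 * Real.log (5 : ℝ) + 2 * Real.log (2 : ℝ)) := by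
  obtain ⟨m12_13_15a, m12_13_15b, m12_13_15c⟩ := zp_2_19_on_0_2_3_8_20_33_mult_12_13_15
  have hr_12_13_15 : 7 * Real.log (7 : ℝ) + 5 * (Real.log |c 12| + Real.log (485431298352000000 : ℝ)) + 2 * (Real.log |c 15| + Real.log (4044526364196864000 : ℝ)) ≤ 7 * (Real.log |c 13| + Real.log (469934352276480000 : ℝ)) + 5 * Real.log (5 : ℝ) + 2 * Real.log (2 : ℝ) := by
    have h := circuit_row_logs_of_table he hZ _ hE (show 12 < 13 by norm_num) (show 13 < 15 by norm_num) (show 15 < 18 by norm_num) 2 5 (by decide) (by decide) _ _ _ m12_13_15a m12_13_15b m12_13_15c; norm_num only [Nat.cast_add, Nat.cast_ofNat] at h; linarith only [h]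
  exact hr_12_13_15

end Summit.ValiantsHypothesis.ValiantsHypothesis.Theorems.LacunarySymmetroidMatrixDescartes.Census
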